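import Summits.CriticalPhenomena.PercolationContinuityZ3.Theorems.PercNearOneGluingNoHeavyLowerTailMajorityGluingTypeTable
import HarnessLib

/-!
# LP dual certificates for the fixed-`M` programmes on the 94-type table — the exact verifier's bound as a kernel check
(lane prim-rate, constants-miner 1, gen 28; RIGOROUS-CERTIFICATION.md §1 «THE BOUND» / «VALID U_j», CONVEX-BOOTSTRAP.md §5)

Support file for the closed crux `NoHeavyLowerTail` (stmt-CriticalPhenomena-4575), majority-gluing line; companion of
`…MajorityGluingTypeTable` (the table and `lin`).  The lane's window certificates (gens 25–26) are LP DUALS: a programme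
is a list of rows `lin φ_i x ≤ b_i` (integer functionals `φ_i` on the types — the linear vdBHK rows, band / cell rows,
and the outward-rounded tangent rows of the power constraints — with rational right-hand sides), an objective
`lin c x` (`c = e`, or a support functional), nonnegative rational multipliers `y`, and the claimed value `V`.  The exact
verifier of gen 26 (`c26/rigbuild.rigorous_bound`) accepts when

  `V ≥ Σ_i y_i b_i + Σ_τ U_τ · (c_τ − Σ_i y_i φ_i(τ))⁺`  with the VALID variable bounds `U_τ = 1`

(every non-inert type has a cut relay `w`, so `x_τ ≤ x(v_w cut) ≤ x(v₁ cut) ≤ 1` by the budget rows and the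
normalisation) — dual deficits are ABSORBED, never tolerated.  This file makes that acceptance test a computable
`Bool` (`checkCert`, decidable by `decide +kernel` on explicit data) and proves it SOUND once and for all
(`lpCert_sound`): for every nonnegative law with `x_τ ≤ 1` on the non-inert types that satisfies the rows,
`lin c x ≤ V`.  `nonInert_le_one` supplies the bound `x_τ ≤ 1` from the normalisation `x(v₁ cut) ≤ 1` and the
budgets `B₂, B₃, B₄`; `ustar1_lp` replays the clean certificate USTAR₁ (BENCH l.234) in this format as a smoke test
of the kernel evaluation.  Pure list arithmetic; no percolation, no sorries.
[cite: VandenbergHaggstromKahn2005, Thm. 1.3 (p. 6)]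
-/

namespace Summit.CriticalPhenomena.PercolationContinuityZ3.Theorems

namespace HubOnly
namespace TypeTable

open DType

/-! ### Certificates as data -/

/-- A row of a programme on the type table: an integer functional `φ` and a rational right-hand side `b`, read as the
hypothesis `lin φ x ≤ b` on a law `x`. -/
structure Row where
  /-- the row functional (integer-valued on the types) -/
  φ : DType → ℤ
  /-- the right-hand side -/
  b : ℚ

/-- The column residuals `c_τ − Σ_i y_i φ_i(τ)` of an objective against multipliers `y` on `rows` (as a function on
types; recursion along the row list, surplus multipliers / rows are ignored). -/
def resid : (DType → ℚ) → List Row → List ℚ → DType → ℚ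
  | c, [], _ => c
  | c, _ :: _, [] => c
  | c, r :: rs, yi :: ys => resid (fun τ => c τ - yi * (r.φ τ : ℚ)) rs ys

/-- The dual value `Σ_i y_i b_i`. -/
def dualValue : List Row → List ℚ → ℚ
  | [], _ => 0
  | _ :: _, [] => 0
  | r :: rs, yi :: ys => yi * r.b + dualValue rs ys

/-- The absorbed deficit `Σ_{τ non-inert} (ψ τ)⁺` of a residual functional (variable bounds `U_τ = 1`). -/
def slack (ψ : DType → ℚ) : ℚ := (allTypes.map fun τ => if τ.inert then 0 else max (ψ τ) 0).sum

/-- **The acceptance test of an LP dual certificate** (gen 26's exact verifier, `U ≡ 1`): as many multipliers as rows,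
`y ≥ 0`, nonpositive residual on the inert types (which carry no variable bound), and
`Σ_i y_i b_i + Σ_{τ non-inert} (c_τ − Σ_i y_i φ_i(τ))⁺ ≤ V`. -/
def checkCert (c : DType → ℤ) (rows : List Row) (y : List ℚ) (V : ℚ) : Bool :=
  decide (rows.length = y.length) && y.all (fun yi => decide (0 ≤ yi)) &&
    allTypes.all (fun τ => !τ.inert || decide (resid (fun σ => (c σ : ℚ)) rows y τ ≤ 0)) &&
    decide (dualValue rows y + slack (resid (fun σ => (c σ : ℚ)) rows y) ≤ V)

/-! ### Soundness -/

noncomputable section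

/-- `Σ_τ ψ(τ)x_τ` for a rational functional (the `ℚ`-valued analogue of `lin`). -/
def linQ (ψ : DType → ℚ) (x : DType → ℝ) : ℝ := (allTypes.map fun τ => (ψ τ : ℝ) * x τ).sum

/-- `linQ` of an integer functional is `lin`. -/
theorem linQ_intCast (c : DType → ℤ) (x : DType → ℝ) : linQ (fun τ => (c τ : ℚ)) x = lin c x := by
  unfold linQ lin
  simp only [Rat.cast_intCast]

/-- One dual step on a list: `Σ ψx = Σ (ψ − y·φ)x + y·Σ φx`. -/
private theorem sum_step (l : List DType) (ψ : DType → ℚ) (yi : ℚ) (φ : DType → ℤ) (x : DType → ℝ) :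
    (l.map fun τ => (ψ τ : ℝ) * x τ).sum =
      (l.map fun τ => (((fun σ => ψ σ - yi * (φ σ : ℚ)) τ : ℚ) : ℝ) * x τ).sum
        + yi * (l.map fun τ => (φ τ : ℝ) * x τ).sum := by
  induction l with
  | nil => simp
  | cons τ l ih =>
    simp only [List.map_cons, List.sum_cons, ih]
    push_cast
    ring

/-- One dual step: `linQ ψ x = linQ (ψ − y·φ) x + y·lin φ x`. -/
theorem linQ_step (ψ : DType → ℚ) (yi : ℚ) (φ : DType → ℤ) (x : DType → ℝ) :
    linQ ψ x = linQ (fun τ => ψ τ - yi * (φ τ : ℚ)) x + yi * lin φ x := sum_step allTypes ψ yi φ x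

/-- **Weak duality along the row list.**  If the rows hold for `x` and `y ≥ 0` then
`linQ ψ x ≤ linQ (resid ψ rows y) x + Σ_i y_i b_i`. -/
theorem linQ_le_resid (x : DType → ℝ) (rows : List Row) :
    ∀ (y : List ℚ) (ψ : DType → ℚ), rows.length = y.length → (∀ yi ∈ y, 0 ≤ yi) →
      (∀ r ∈ rows, lin r.φ x ≤ (r.b : ℝ)) →
        linQ ψ x ≤ linQ (resid ψ rows y) x + (dualValue rows y : ℝ) := by
  induction rows with
  | nil =>
    intro y ψ _ _ _
    simp [resid, dualValue]
  | cons r rs ih =>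
    intro y ψ hlen hy hrows
    cases y with
    | nil => simp at hlen
    | cons yi ys =>
      simp only [resid, dualValue]
      have hih := ih ys (fun τ => ψ τ - yi * (r.φ τ : ℚ)) (by simpa using hlen)
        (fun z hz => hy z (List.mem_cons_of_mem _ hz)) (fun r' hr' => hrows r' (List.mem_cons_of_mem _ hr'))
      have hstep := linQ_step ψ yi r.φ x
      have hr := hrows r (by simp)
      have hyi : (0 : ℝ) ≤ (yi : ℝ) := by exact_mod_cast hy yi (by simp)
      have hprod : (yi : ℝ) * lin r.φ x ≤ (yi : ℝ) * (r.b : ℝ) := mul_le_mul_of_nonneg_left hr hyi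
      push_cast
      linarith

/-- The absorbed deficit bounds the residual mass: `ψ ≤ 0` on inert types, `0 ≤ x`, and `x_τ ≤ 1` on the non-inert
types give `linQ ψ x ≤ slack ψ`. -/
private theorem sum_le_slack (l : List DType) (ψ : DType → ℚ) (x : DType → ℝ) (hx : ∀ τ, 0 ≤ x τ)
    (h1 : ∀ τ ∈ l, τ.inert = false → x τ ≤ 1) (hin : ∀ τ ∈ l, τ.inert = true → ψ τ ≤ 0) :
    (l.map fun τ => (ψ τ : ℝ) * x τ).sum ≤
      ((l.map fun τ => if τ.inert then 0 else max (ψ τ) 0).sum : ℚ) := by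
  induction l with
  | nil => simp
  | cons τ l ih =>
    simp only [List.map_cons, List.sum_cons]
    have hih := ih (fun σ hσ => h1 σ (List.mem_cons_of_mem _ hσ)) (fun σ hσ => hin σ (List.mem_cons_of_mem _ hσ))
    have hτ : (ψ τ : ℝ) * x τ ≤ ((if τ.inert then 0 else max (ψ τ) 0 : ℚ) : ℝ) := by
      cases h : τ.inert
      · simp only [Bool.false_eq_true, ↓reduceIte]
        have hx1 := h1 τ (by simp) h
        have hm : (ψ τ : ℝ) ≤ ((max (ψ τ) 0 : ℚ) : ℝ) := by exact_mod_cast le_max_left _ _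
        have hm0 : (0 : ℝ) ≤ ((max (ψ τ) 0 : ℚ) : ℝ) := by exact_mod_cast le_max_right _ _
        calc (ψ τ : ℝ) * x τ ≤ ((max (ψ τ) 0 : ℚ) : ℝ) * x τ := mul_le_mul_of_nonneg_right hm (hx τ)
          _ ≤ ((max (ψ τ) 0 : ℚ) : ℝ) * 1 := mul_le_mul_of_nonneg_left hx1 hm0
          _ = _ := by ring
      · simp only [↓reduceIte, Rat.cast_zero]
        have hψ : (ψ τ : ℝ) ≤ 0 := by exact_mod_cast hin τ (by simp) h
        exact mul_nonpos_of_nonpos_of_nonneg hψ (hx τ)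
    push_cast at hih ⊢
    linarith

/-- `linQ ψ x ≤ slack ψ` under the hypotheses of `sum_le_slack` on the whole table. -/
theorem linQ_le_slack (ψ : DType → ℚ) (x : DType → ℝ) (hx : ∀ τ, 0 ≤ x τ)
    (h1 : ∀ τ ∈ allTypes, τ.inert = false → x τ ≤ 1) (hin : ∀ τ ∈ allTypes, τ.inert = true → ψ τ ≤ 0) :
    linQ ψ x ≤ (slack ψ : ℝ) := sum_le_slack allTypes ψ x hx h1 hin

/-- **SOUNDNESS OF THE LP CERTIFICATES.**  If `checkCert c rows y V = true`, then every nonnegative law with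
`x_τ ≤ 1` on the non-inert types that satisfies all rows (`lin φ_i x ≤ b_i`) has `lin c x ≤ V`. -/
theorem lpCert_sound {c : DType → ℤ} {rows : List Row} {y : List ℚ} {V : ℚ}
    (hcert : checkCert c rows y V = true) (x : DType → ℝ) (hx : ∀ τ, 0 ≤ x τ)
    (h1 : ∀ τ ∈ allTypes, τ.inert = false → x τ ≤ 1) (hrows : ∀ r ∈ rows, lin r.φ x ≤ (r.b : ℝ)) :
    lin c x ≤ (V : ℝ) := by
  unfold checkCert at hcert
  simp only [Bool.and_eq_true, decide_eq_true_eq, List.all_eq_true, Bool.or_eq_true, Bool.not_eq_true'] at hcert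
  obtain ⟨⟨⟨hlen, hy⟩, hinert⟩, hV⟩ := hcert
  have hdual := linQ_le_resid x rows y (fun σ => (c σ : ℚ)) hlen hy hrows
  have hsl := linQ_le_slack (resid (fun σ => (c σ : ℚ)) rows y) x hx h1 (fun τ hτ hi => by
    have := hinert τ hτ
    rcases this with h | h
    · rw [hi] at h; exact absurd h (by decide)
    · exact h)
  rw [linQ_intCast] at hdual
  have hV' : ((dualValue rows y + slack (resid (fun σ => (c σ : ℚ)) rows y) : ℚ) : ℝ) ≤ (V : ℝ) := by
    exact_mod_cast hV
  push_cast at hV'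
  linarith

/-! ### The variable bounds `x_τ ≤ 1` -/

/-- A single mass is at most the mass of any event containing its type. -/
private theorem sum_single_le (l : List DType) (A : DType → Bool) (x : DType → ℝ) (hx : ∀ τ, 0 ≤ x τ)
    (τ₀ : DType) (h0 : τ₀ ∈ l) (hA : A τ₀ = true) :
    x τ₀ ≤ (l.map fun τ => (ind (A τ) : ℝ) * x τ).sum := by
  induction l with
  | nil => simp at h0
  | cons τ l ih =>
    simp only [List.map_cons, List.sum_cons]
    have hnn : ∀ l' : List DType, 0 ≤ (l'.map fun τ => (ind (A τ) : ℝ) * x τ).sum := by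
      intro l'
      induction l' with
      | nil => simp
      | cons σ l' ih' =>
        simp only [List.map_cons, List.sum_cons]
        have : 0 ≤ (ind (A σ) : ℝ) * x σ := mul_nonneg (by unfold ind; split <;> simp) (hx σ)
        linarith
    rcases List.mem_cons.mp h0 with rfl | hmem
    · have : (ind (A τ₀) : ℝ) * x τ₀ = x τ₀ := by rw [hA]; simp [ind]
      rw [this]
      linarith [hnn l]
    · have hih := ih hmem
      have : 0 ≤ (ind (A τ) : ℝ) * x τ := mul_nonneg (by unfold ind; split <;> simp) (hx τ)
      linarith

/-- `x_τ ≤ x(A)` for `τ ∈ A`. -/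
theorem single_le_lin (A : DType → Bool) (x : DType → ℝ) (hx : ∀ τ, 0 ≤ x τ) (τ₀ : DType)
    (h0 : τ₀ ∈ allTypes) (hA : A τ₀ = true) : x τ₀ ≤ lin (fun τ => ind (A τ)) x :=
  sum_single_le allTypes A x hx τ₀ h0 hA

/-- Every non-inert type has a cut relay (typewise). -/
theorem exists_cut_of_nonInert : ∀ τ ∈ allTypes, τ.inert = false →
    (τ.cut 1 || τ.cut 2 || τ.cut 3 || τ.cut 4) = true := by decide +kernel

/-- `cut_w = B_w + cut₁` typewise (`w = 2,3,4`), and `cut_w` is the indicator of `v_w cut`. -/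
theorem cutZ_eq : ∀ τ ∈ allTypes, ∀ w ∈ [2, 3, 4],
    τ.cutZ w = τ.bud w + τ.cutZ 1 ∧ τ.cutZ w = ind (τ.cut w) ∧ τ.cutZ 1 = ind (τ.cut 1) := by decide +kernel

/-- `x(v_w cut) ≤ x(v₁ cut)` under the budget row `B_w` (`w = 2,3,4`), as masses of indicator events. -/
theorem cut_mass_le (x : DType → ℝ) (w : ℕ) (hw : w ∈ [2, 3, 4]) (hB : lin (fun τ => τ.bud w) x ≤ 0) :
    lin (fun τ => ind (τ.cut w)) x ≤ lin (fun τ => ind (τ.cut 1)) x := by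
  have e1 : lin (fun τ => ind (τ.cut w)) x = lin (fun τ => τ.cutZ w) x := by
    unfold lin; exact congrArg List.sum (List.map_congr_left fun τ hτ => by simp only [(cutZ_eq τ hτ w hw).2.1])
  have e2 : lin (fun τ => ind (τ.cut 1)) x = lin (fun τ => τ.cutZ 1) x := by
    unfold lin; exact congrArg List.sum (List.map_congr_left fun τ hτ => by simp only [(cutZ_eq τ hτ w hw).2.2])
  have e3 : lin (fun τ => τ.cutZ w) x = lin (fun τ => τ.bud w) x + lin (fun τ => τ.cutZ 1) x := by
    have h := linQ_step (fun τ => (τ.cutZ w : ℚ)) 1 (fun τ => τ.bud w) x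
    rw [linQ_intCast] at h
    have e : linQ (fun τ => (τ.cutZ w : ℚ) - 1 * (τ.bud w : ℚ)) x = lin (fun τ => τ.cutZ 1) x := by
      rw [← linQ_intCast]
      unfold linQ
      refine congrArg List.sum (List.map_congr_left fun τ hτ => ?_)
      simp only []
      rw [(cutZ_eq τ hτ w hw).1]
      push_cast
      ring
    rw [e] at h
    simp only [Rat.cast_one, one_mul] at h
    linarith
  rw [e1, e2, e3]
  linarith

/-- **The variable bounds.**  Under the normalisation `x(v₁ cut) ≤ 1` and the budgets `B₂, B₃, B₄`, every non-inert
type has mass at most `1` — the `U_τ = 1` of the exact verifier. -/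
theorem nonInert_le_one (x : DType → ℝ) (hx : ∀ τ, 0 ≤ x τ) (hnorm : lin (fun τ => τ.cutZ 1) x ≤ 1)
    (hB2 : lin (fun τ => τ.bud 2) x ≤ 0) (hB3 : lin (fun τ => τ.bud 3) x ≤ 0)
    (hB4 : lin (fun τ => τ.bud 4) x ≤ 0) : ∀ τ ∈ allTypes, τ.inert = false → x τ ≤ 1 := by
  intro τ hτ hni
  have hcut1 : lin (fun σ => ind (σ.cut 1)) x ≤ 1 := by
    have e : lin (fun σ => ind (σ.cut 1)) x = lin (fun σ => σ.cutZ 1) x := by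
      unfold lin
      exact congrArg List.sum (List.map_congr_left fun σ hσ => by simp only [(cutZ_eq σ hσ 2 (by simp)).2.2])
    rw [e]; exact hnorm
  have h := exists_cut_of_nonInert τ hτ hni
  simp only [Bool.or_eq_true] at h
  rcases h with ((h1 | h2) | h3) | h4
  · exact (single_le_lin (fun σ => σ.cut 1) x hx τ hτ h1).trans hcut1
  · exact (single_le_lin (fun σ => σ.cut 2) x hx τ hτ h2).trans ((cut_mass_le x 2 (by simp) hB2).trans hcut1)
  · exact (single_le_lin (fun σ => σ.cut 3) x hx τ hτ h3).trans ((cut_mass_le x 3 (by simp) hB3).trans hcut1)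
  · exact (single_le_lin (fun σ => σ.cut 4) x hx τ hτ h4).trans ((cut_mass_le x 4 (by simp) hB4).trans hcut1)

end

/-! ### Smoke test: the clean certificate USTAR₁ as an LP certificate -/

/-- USTAR₁ (BENCH l.234) in LP form: objective `2e − u₂₃₄ + 2·(1[C₁₂] + 1[C₁₃] + 1[C₁₄])`, rows `B₂, O_dn4_23, O_up4_23`
(right-hand sides `0`), multipliers `(2, 1, 1)`, value `0` — accepted by `checkCert` (no deficit anywhere). -/
theorem ustar1_checkCert :
    checkCert (fun τ => 2 * τ.eZ - τ.uZ [2, 3, 4] + 2 * (ind (τ.isC 1 2) + ind (τ.isC 1 3) + ind (τ.isC 1 4)))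
      [⟨fun τ => τ.bud 2, 0⟩, ⟨fun τ => τ.odn 4 2 3, 0⟩, ⟨fun τ => τ.oup 4 2 3, 0⟩] [2, 1, 1] 0 = true := by
  decide +kernel

end TypeTable
end HubOnly

end Summit.CriticalPhenomena.PercolationContinuityZ3.Theorems
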